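import Summits.ResolutionOfSingularities.ResolutionOfSingularities.Theorems.RisoStrataDescentAlgclosedToPerfectGaloisInvariant

/-!
# Line `aut-invariant-resolving-ideal` for crux `DescentAlgclosedToPerfect` (stmt-ResolutionOfSingularities-0550)

Seed line written by the line lead gen 1 (prover-line-stmt-ResolutionOfSingularities-0550-0,
2026-08-17), superseding the seed `rational_resolving_ideal` (same lead): all 14 payload lines were
lines of OTHER cruxes (`Lines/payload-lines-ineligible-dead.md`). Card:
`Lines/aut-invariant-resolving-ideal.md`; analysis: `Cruxes/DescentAlgclosedToPerfect/NOTES.md`.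

Composition: `DescentAlgclosedToPerfect_of : stub_autInvariantResolvingIdeal → crux`, ONE LINE from
the landed `Theorems.descentAlgclosedToPerfect_of_autInvariantResolvingIdeal`, which packages:
reduced ⇒ integral (`ComponentGluing`); an `Aut(k̄/k)`-invariant ideal sheaf on `X_{k̄}` comes from
a finite normal stage, equivariantly (`Motives/GaloisInvariantIdealSheafStage`, EGA IV₃ 8.8.2 +
`AlgEquiv.liftNormal`); finite Galois descent of ideal sheaves (`Motives/GaloisDescentIdealSheaf`,
Speiser); blow-up resolutions along ideals of the base descend along field extensions
(`Theorems.hasResolution_of_isBlowup_comap_fieldExtension`, flat base change + flat descent of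
regularity).

The single stub is the honest residue of the crux, in the form every invariant-driven resolution
algorithm over `k̄` delivers and bare existence (the antecedent as typed) does not: for `X` integral
separated of finite type over a PERFECT `k`, a non-zero ideal sheaf on `X ×_k Spec k̄`, invariant
under all `σ ∈ Aut(k̄/k)` acting through the second factor (`GaloisDescent.gal`), whose blow-up is
regular (Kollár 2007, 3.34.1–3.34.2 / Thm. 3.36; BGMW 2011, Remark p. 23).
-/

noncomputable section

set_option linter.dupNamespace false

open CategoryTheory CategoryTheory.Limits AlgebraicGeometry
open Literature.AlgebraicGeometry.Resolution Literature.AlgebraicGeometry.Motives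

namespace Summit.ResolutionOfSingularities.ResolutionOfSingularities.Cruxes.DescentAlgclosedToPerfect.Lines.AutInvariantResolvingIdeal

/-- STUB `stub_autInvariantResolvingIdeal` (OPEN — the residue of the crux): resolution over all
algebraically closed fields of characteristic `p` yields, for every integral separated scheme `X` of
finite type over a perfect field `k` of characteristic `p`, a non-zero ideal sheaf on
`X ×_k Spec k̄` (`k̄ = AlgebraicClosure k`) invariant under `Aut(k̄/k)` and with REGULAR blow-up. -/
theorem stub_autInvariantResolvingIdeal : ∀ p : ℕ, p.Prime →
    (∀ (k : Type) [Field k] [CharP k p] [IsAlgClosed k] (X : Scheme.{0}) (f : X ⟶ Spec (.of k)),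
      IsSeparated f → LocallyOfFiniteType f → QuasiCompact f → IsReduced X →
      Scheme.HasResolution X) →
    ∀ (k : Type) [Field k] [CharP k p] [PerfectField k] (X : Scheme.{0}) (f : X ⟶ Spec (.of k)),
      IsSeparated f → LocallyOfFiniteType f → QuasiCompact f → IsIntegral X →
      ∃ (I : (GaloisDescent.bc (AlgebraicClosure k) (Over.mk f)).IdealSheafData) (Y : Scheme.{0})
        (ρ : Y ⟶ GaloisDescent.bc (AlgebraicClosure k) (Over.mk f)),
        I ≠ ⊥ ∧ (∀ σ : AlgebraicClosure k ≃ₐ[k] AlgebraicClosure k,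
          I.comap (GaloisDescent.gal (AlgebraicClosure k) (Over.mk f) σ) = I) ∧
          IsBlowup ρ I ∧ Scheme.IsRegular Y := by
  sorry

/-- COMPOSITION: the stub gives the crux BY NAME. -/
theorem DescentAlgclosedToPerfect_of :
    Summit.ResolutionOfSingularities.ResolutionOfSingularities.Theses.RisoStrata.DescentAlgclosedToPerfect :=
  Theorems.descentAlgclosedToPerfect_of_autInvariantResolvingIdeal stub_autInvariantResolvingIdeal

end Summit.ResolutionOfSingularities.ResolutionOfSingularities.Cruxes.DescentAlgclosedToPerfect.Lines.AutInvariantResolvingIdeal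

end
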